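import Summits.QuantumFields.BalabanUV.Beta.GAN24.LayerPushEntry
import Summits.QuantumFields.BalabanUV.Beta.GAN24.BlockDivergenceFlux

/-!
# `BalabanUV.Beta.GAN24.LayerPushGradEntry` — binder row G-an2-4 / (CONV-C), W-slot CT-W, route «WC-TL» ∕ «QR-LL» (the OWNER gan24-p1 g25's `gen25/QR-DESIGN-v0.md` §3),
# row **(LT-Δ) «LAYER TRANSPORT IN DIFFERENCE FORM»**, part (LT-1′) — WHERE THE BOUNDARY TERM GOES (RULING R-gan24p1-g25-2 (3), journal l.39869; this lineage's
# answer R-leaf01-g63-3, l.40042): the boundary term DISPLAYED for an across-the-box difference (§3), ABSENT by `tsum` shift-invariance for a unit difference in the live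
# slot (§1), and the weighted entry estimate of the three-leg push with the table leg's GRADIENT constant in that case (§2)

NOT IN PRINT; OUR BOOKKEEPING ([folklore] summation by parts on `ℤ^{d+1}` and on a finite region, over leaf-01 g43's `Push3.push₃`, this lineage's `LayerPushEntry`
(p318356) and leaf-03 g58's `BlockDivergenceFlux.finsetSum_sub_shift_eq_layers` (p317372); G-an2-4 formalisation swarm, leaf prover `b2b-balaban-gan24-formalise-leaf-01`,
gen 63).  HONEST FRAMING (cell contract, verbatim): «discharging `BetaPertH` makes Bałaban's UV stability UNCONDITIONAL — a real constructive-QFT result; it is NOT the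
continuum limit and NOT the Clay problem.»  HONEST DEPENDENCY (verbatim): «continuum YM on T⁴ ⇐ BetaPertH ∧ nine spine estimates (0/9 proved); BetaPertH ⇐ (D1) ∧ (D4) ∧
CAP+tail; G-an2-4 gates asym, D1 and NE2/3/4.»

## What (generic `d`, generic legs ∕ weights ∕ families — no object of an2's typed system occurs)
§1 **NO BOUNDARY TERM FOR A UNIT DIFFERENCE IN THE LIVE SLOT** (`tsum` shift-invariance on `ℤ^{D}`): `wsum w (u ↦ K (u+e) − K u) = wsum (u ↦ w (u−e) − w u) K`
   (`wsum_fwdDiff_eq`, given summability of the two slot series), hence for the weighted vertex and the three-leg push: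
   `vertexW w (k u ↦ S k (u+e) − S k u) = vertexW (ν U k u ↦ w ν U k (u−e) − w ν U k u) S` (`vertexW_fwdDiff_eq`) and
   **`push₃ l r w (∇⁺_e S) = push₃ l r (∇⁻_e w) S`** (`push₃_fwdDiff_eq`) — the unit difference of the family becomes the unit (backward) difference of the TABLE LEG, over
   the whole lattice, with NO boundary term; summability is discharged from the coarse envelope of `w` and the weighted envelope of `S` (`summable_slot`).
§2 **THE WEIGHTED ENTRY ESTIMATE WITH THE GRADIENT CONSTANT** (`abs_push₃_fwdDiff_inl_inl_le_weighted`): under the hypotheses of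
   `LayerPushEntry.abs_push₃_inl_inl_le_weighted` for `l, r, S, ω` PLUS a coarse envelope for the unit backward difference of the table leg,
   `|w ν U k (u−e) − w ν U k u| ≤ Cw′·e^{−κ‖quo N u − U‖₁}`, the push of the DIFFERENCED family `∇⁺_e S` obeys the bound of that theorem with `Cw` REPLACED BY `Cw′`
   and the weighted block count `Σ'_u ω u·e^{−(κ∕2)‖quo N u − U‖₁}` of `S`'s OWN support: the support (shell) and the gradient sit on the SAME term.  With a response-step
   table leg, `Cw′` is (N1′)'s gradient constant (`RespStepDecay.exists_respStep_decay_and_grad`: one power of the blocking better than `Cw`).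
§3 **THE BOUNDARY TERM OF AN ACROSS-THE-BOX DIFFERENCE, DISPLAYED** (`finsetSum_mul_bwdDiff_eq`): for a finite region `B`, any commutative ring,
   `Σ_{u∈B} w u·(T u − T (u−e)) = (Σ_{u ∈ B∖(B−e)} w (u+e)·T u − Σ_{v ∈ (B−e)∖B} w (v+e)·T v) − Σ_{u∈B} (w (u+e) − w u)·T u` (`B − e := B.image (· − e)`):
   BOUNDARY = the two `e`-layers of `B` carrying the table leg UNDIFFERENCED, BULK = all of `B` against the unit gradient of the table leg — the shell restriction and
   the gradient gain fall on DIFFERENT terms (the OWNER's located objection (3), as an identity; leaf-03's `finsetSum_sub_shift_eq_layers` at `h := w(·+e)·T` plus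
   `Finset.sum_sub_distrib`).
[folklore]; 0 cited facts, 0 `def`, 0 `def … : Prop`, 0 sorry.  Asserts NOTHING about an2's towers or about which letters of QR-LL have the §1 form; NEVER «G-an2-4
closed» as (CONV-C); NOT D1, NOT `BetaPertH`, NOT continuum, NOT Clay.  2026-08-22.
-/

noncomputable section

open Finset
open scoped BigOperators
open Literature.MathematicalPhysics.QuantumFieldTheory
open Literature.MathematicalPhysics.QuantumFieldTheory.Balaban1983to89
open Literature.MathematicalPhysics.QuantumFieldTheory.Balaban1983to89.Beta
open B12Sec2to5 (l1 l1_nonneg)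
open ExpKernelCalculus (MKer Zl summable_exp_shift)
open OneStepResolventKernel (Fib wsum)
open LatticeForm (quo)
open KKTFluctuationEnergy (tsum_shift)
open Summit.QuantumFields.BalabanUV.Beta.GAN24.Push4 (vertexW vertexW_apply)
open Summit.QuantumFields.BalabanUV.Beta.GAN24.Push3 (push₃ push₃_inl_inl push₃_def)
open Summit.QuantumFields.BalabanUV.Beta.GAN24.Push4TwoRate (summable_leg)
open Summit.QuantumFields.BalabanUV.Beta.GAN24.LayerPushEntry (abs_push₃_inl_inl_le_weighted)
open Summit.QuantumFields.BalabanUV.Beta.GAN24.BlockDivergenceFlux (finsetSum_sub_shift_eq_layers)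

namespace Summit.QuantumFields.BalabanUV.Beta.GAN24.LayerPushGradEntry

variable {d : ℕ}

/-! ## §1 Summation by parts in the live slot over the whole lattice: no boundary term -/

/-- [folklore] **NO BOUNDARY TERM** (`tsum` shift-invariance): the weighted superposition of the unit FORWARD difference of a family is the superposition of the
family against the unit BACKWARD difference of the weight, `Σ'_u w u·(K (u+e) − K u) = Σ'_u (w (u−e) − w u)·K u`, whenever the two slot series converge. -/
theorem wsum_fwdDiff_eq {D : ℕ} {F : Type*} (w : (Fin D → ℤ) → ℝ) (K : (Fin D → ℤ) → MKer D F) (e x z : Fin D → ℤ) (a b : F)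
    (h₁ : Summable fun u => w u * K (u + e) x z a b) (h₂ : Summable fun u => w u * K u x z a b) :
    wsum w (fun u => K (u + e) - K u) x z a b = wsum (fun u => w (u - e) - w u) K x z a b := by
  have h₃ : Summable fun u => w (u - e) * K u x z a b := by
    have : (fun u => w (u - e) * K u x z a b) = (fun u => w u * K (u + e) x z a b) ∘ (Equiv.subRight e) := by
      funext u; simp only [Function.comp_apply, Equiv.subRight_apply, sub_add_cancel]
    rw [this]; exact (Equiv.subRight e).summable_iff.mpr h₁
  have hs : ∑' u, w u * K (u + e) x z a b = ∑' u, w (u - e) * K u x z a b := by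
    rw [← tsum_shift (fun u => w (u - e) * K u x z a b) e]
    simp only [add_sub_cancel_right]
  simp only [wsum, Pi.sub_apply, mul_sub, sub_mul]
  rw [h₁.tsum_sub h₂, h₃.tsum_sub h₂, hs]

variable {l r w : Fin (d + 1) → (Fin (d + 1) → ℤ) → Fin (d + 1) → (Fin (d + 1) → ℤ) → ℝ}
  {S : Fin (d + 1) → (Fin (d + 1) → ℤ) → MKer (d + 1) (Fib d)} {ω : (Fin (d + 1) → ℤ) → ℝ} {N : ℕ} {Cl Cr Cw Cw' Cs κ m Ω : ℝ}

/-- [folklore] **THE SLOT SERIES CONVERGE** under the coarse envelope of the table leg and the weighted envelope of the family (any shift `v` of the family's slot):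
`u ↦ w ν U k u · S k (u+v) x z a b` is summable — dominated by `Cw·Cs·Ω·e^{−κ‖quo N u − U‖₁}` (leaf-03's `summable_leg`). -/
theorem summable_slot (hN : 1 ≤ N) (hw : ∀ ν U k u, |w ν U k u| ≤ Cw * Real.exp (-κ * l1 (quo N u - U)))
    (hS : ∀ k u x z a b, |S k u x z a b| ≤ Cs * ω u * Real.exp (-m * (l1 (x - u) + l1 (z - u))))
    (hω : ∀ u, 0 ≤ ω u ∧ ω u ≤ Ω) (hκ : 0 < κ) (hm : 0 ≤ m)
    (ν : Fin (d + 1)) (U : Fin (d + 1) → ℤ) (k : Fin (d + 1)) (v x z : Fin (d + 1) → ℤ) (a b : Fib d) :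
    Summable fun u => w ν U k u * S k (u + v) x z a b := by
  have hCw : 0 ≤ Cw := (mul_nonneg_iff_of_pos_right (Real.exp_pos _)).mp ((abs_nonneg _).trans (hw 0 0 0 0))
  have hΩ : 0 ≤ Ω := (hω 0).1.trans (hω 0).2
  refine Summable.of_norm_bounded ((summable_leg (d := d) hN hκ U).mul_left (Cw * (|Cs| * Ω))) fun u => ?_
  rw [Real.norm_eq_abs, abs_mul]
  have h1 := hw ν U k u
  have h2 := hS k (u + v) x z a b
  have hω1 := (hω (u + v)).1
  have hω2 := (hω (u + v)).2
  have he : Real.exp (-m * (l1 (x - (u + v)) + l1 (z - (u + v)))) ≤ 1 :=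
    Real.exp_le_one_iff.2 (by nlinarith [l1_nonneg (x - (u + v)), l1_nonneg (z - (u + v))])
  have h3 : |S k (u + v) x z a b| ≤ |Cs| * Ω := by
    refine h2.trans ?_
    calc Cs * ω (u + v) * Real.exp (-m * (l1 (x - (u + v)) + l1 (z - (u + v))))
        ≤ |Cs| * ω (u + v) * Real.exp (-m * (l1 (x - (u + v)) + l1 (z - (u + v)))) :=
          mul_le_mul_of_nonneg_right (mul_le_mul_of_nonneg_right (le_abs_self Cs) hω1) (Real.exp_pos _).le
      _ ≤ |Cs| * Ω * 1 := mul_le_mul (mul_le_mul_of_nonneg_left hω2 (abs_nonneg Cs)) he (Real.exp_pos _).le (by positivity)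
      _ = |Cs| * Ω := mul_one _
  calc |w ν U k u| * |S k (u + v) x z a b| ≤ (Cw * Real.exp (-κ * l1 (quo N u - U))) * (|Cs| * Ω) :=
        mul_le_mul h1 h3 (abs_nonneg _) (by positivity)
    _ = Cw * (|Cs| * Ω) * Real.exp (-κ * l1 (quo N u - U)) := by ring

/-- [folklore] **THE WEIGHTED VERTEX OF A UNIT FORWARD DIFFERENCE** is the vertex of the family against the backward-differenced table leg (§1 under the `κ`-sum). -/
theorem vertexW_fwdDiff_eq (hN : 1 ≤ N) (hw : ∀ ν U k u, |w ν U k u| ≤ Cw * Real.exp (-κ * l1 (quo N u - U)))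
    (hS : ∀ k u x z a b, |S k u x z a b| ≤ Cs * ω u * Real.exp (-m * (l1 (x - u) + l1 (z - u))))
    (hω : ∀ u, 0 ≤ ω u ∧ ω u ≤ Ω) (hκ : 0 < κ) (hm : 0 ≤ m) (e : Fin (d + 1) → ℤ) (ν : Fin (d + 1)) (U : Fin (d + 1) → ℤ) :
    vertexW w (fun k u => S k (u + e) - S k u) ν U
      = vertexW (fun ν' U' k u => w ν' U' k (u - e) - w ν' U' k u) S ν U := by
  funext x z a b
  simp only [vertexW_apply]
  refine Finset.sum_congr rfl fun k _ => ?_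
  have h₁ := summable_slot hN hw hS hω hκ hm ν U k e x z a b
  have h₂ := summable_slot hN hw hS hω hκ hm ν U k 0 x z a b
  simp only [add_zero] at h₂
  exact wsum_fwdDiff_eq (w ν U k) (S k) e x z a b h₁ h₂

/-- [folklore] **`push₃ l r w (∇⁺_e S) = push₃ l r (∇⁻_e w) S`** — the three-leg push of the unit forward difference of the family IS the push of the family through the
backward-differenced table leg: the difference moves onto the response leg over the WHOLE lattice, with no boundary term. -/
theorem push₃_fwdDiff_eq (hN : 1 ≤ N) (hw : ∀ ν U k u, |w ν U k u| ≤ Cw * Real.exp (-κ * l1 (quo N u - U)))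
    (hS : ∀ k u x z a b, |S k u x z a b| ≤ Cs * ω u * Real.exp (-m * (l1 (x - u) + l1 (z - u))))
    (hω : ∀ u, 0 ≤ ω u ∧ ω u ≤ Ω) (hκ : 0 < κ) (hm : 0 ≤ m) (e : Fin (d + 1) → ℤ) (ν : Fin (d + 1)) (U : Fin (d + 1) → ℤ) :
    push₃ l r w (fun k u => S k (u + e) - S k u) ν U = push₃ l r (fun ν' U' k u => w ν' U' k (u - e) - w ν' U' k u) S ν U := by
  rw [push₃_def, push₃_def, vertexW_fwdDiff_eq hN hw hS hω hκ hm e ν U]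

/-! ## §2 The weighted entry estimate of the push of a differenced family: the table leg's GRADIENT constant -/

/-- NOT IN PRINT; OUR BOOKKEEPING ([folklore] §1 then `LayerPushEntry.abs_push₃_inl_inl_le_weighted` with the differenced table leg).
**THE WEIGHTED ENTRY ESTIMATE WITH THE GRADIENT CONSTANT** (generic `d`, relative blocking `N ≥ 1`, rates `κ, m > 0`): kernel legs with coarse envelopes
`|l α x′ κ₁ x| ≤ Cl·e^{−κ‖quo N x − x′‖₁}`, `|r β z′ κ₂ z| ≤ Cr·e^{−κ‖quo N z − z′‖₁}`; table leg with a coarse envelope `|w ν U κ′ u| ≤ Cw·e^{−κ‖quo N u − U‖₁}` (used ONLY for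
the convergence of the slot series) AND a coarse envelope for its unit backward difference `|w ν U κ′ (u−e) − w ν U κ′ u| ≤ Cw′·e^{−κ‖quo N u − U‖₁}`; family with the weighted
slot profile `|S κ′ u x z a b| ≤ Cs·ω u·e^{−m(‖x−u‖₁+‖z−u‖₁)}`, `0 ≤ ω ≤ Ω`.  Then the push of the unit FORWARD DIFFERENCE `κ′ u ↦ S κ′ (u+e) − S κ′ u` obeys, entry by entry,
`|push₃ l r w (∇⁺_e S) ν U x′ z′ (inl α) (inl β)| ≤ (d+1)³·Cl·Cr·Cw′·Cs·Zl_{d+1}(m∕2)² · e^{−τ(‖x′−U‖₁+‖z′−U‖₁)} · Σ'_u ω u·e^{−(κ∕2)‖quo N u − U‖₁}`,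
`τ := min (κ∕4) (min κ (m∕2))` — the GRADIENT constant `Cw′` in place of `Cw`, against the weighted block count of `S`'s OWN support. -/
theorem abs_push₃_fwdDiff_inl_inl_le_weighted (hN : 1 ≤ N) (e : Fin (d + 1) → ℤ)
    (hl : ∀ α x' k x, |l α x' k x| ≤ Cl * Real.exp (-κ * l1 (quo N x - x')))
    (hr : ∀ β z' k z, |r β z' k z| ≤ Cr * Real.exp (-κ * l1 (quo N z - z')))
    (hw : ∀ ν U k u, |w ν U k u| ≤ Cw * Real.exp (-κ * l1 (quo N u - U)))
    (hw' : ∀ ν U k u, |w ν U k (u - e) - w ν U k u| ≤ Cw' * Real.exp (-κ * l1 (quo N u - U)))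
    (hS : ∀ k u x z a b, |S k u x z a b| ≤ Cs * ω u * Real.exp (-m * (l1 (x - u) + l1 (z - u))))
    (hω : ∀ u, 0 ≤ ω u ∧ ω u ≤ Ω) (hκ : 0 < κ) (hm : 0 < m) (hCl : 0 ≤ Cl) (hCr : 0 ≤ Cr) (hCw' : 0 ≤ Cw') (hCs : 0 ≤ Cs)
    (ν : Fin (d + 1)) (U x' z' : Fin (d + 1) → ℤ) (α β : Fin (d + 1)) :
    |push₃ l r w (fun k u => S k (u + e) - S k u) ν U x' z' (Sum.inl α) (Sum.inl β)| ≤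
      (((d : ℝ) + 1) ^ 3 * (Cl * Cr * Cw' * Cs) * Zl (d + 1) (m / 2) ^ 2) *
        Real.exp (-(min (κ / 4) (min κ (m / 2))) * (l1 (x' - U) + l1 (z' - U))) *
          ∑' u : Fin (d + 1) → ℤ, ω u * Real.exp (-(κ / 2) * l1 (quo N u - U)) := by
  rw [push₃_fwdDiff_eq hN hw hS hω hκ hm.le e ν U]
  exact abs_push₃_inl_inl_le_weighted hN hl hr (fun ν U k u => hw' ν U k u) hS hω hκ hm hCl hCr hCw' hCs ν U x' z' α β

/-! ## §3 A finite region: the boundary term of an across-the-box difference, displayed -/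

/-- [folklore] **THE BOUNDARY TERM, DISPLAYED** (discrete Leibniz rule on a finite region; leaf-03's `finsetSum_sub_shift_eq_layers` at `h := w(·+e)·T` plus
`Finset.sum_sub_distrib`): for a finite set `B` of sites, a weight `w`, a family `T` (values in a commutative ring) and a translation `e`, with `B − e := B.image (· − e)`,
`Σ_{u∈B} w u·(T u − T (u−e)) = (Σ_{u ∈ B ∖ (B−e)} w (u+e)·T u − Σ_{v ∈ (B−e) ∖ B} w (v+e)·T v) − Σ_{u∈B} (w (u+e) − w u)·T u`:
the BOUNDARY (the two `e`-layers of `B`, the weight UNDIFFERENCED) and the BULK (all of `B`, against the unit gradient of the weight) are different terms — a sum of a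
unit difference ACROSS a box gives the layer restriction or the gradient, never both on one term. -/
theorem finsetSum_mul_bwdDiff_eq {R : Type*} [CommRing R] (B : Finset (Fin (d + 1) → ℤ)) (w T : (Fin (d + 1) → ℤ) → R) (e : Fin (d + 1) → ℤ) :
    ∑ u ∈ B, w u * (T u - T (u - e))
      = (∑ u ∈ B \ B.image (fun u => u - e), w (u + e) * T u - ∑ v ∈ B.image (fun u => u - e) \ B, w (v + e) * T v)
          - ∑ u ∈ B, (w (u + e) - w u) * T u := by
  have hlay := finsetSum_sub_shift_eq_layers (d := d) B (fun u => w (u + e) * T u) e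
  have hpt : ∀ u, w u * (T u - T (u - e))
      = -((fun u => w (u + e) * T u) (u - e) - (fun u => w (u + e) * T u) u) - (w (u + e) - w u) * T u := by
    intro u
    simp only [sub_add_cancel]
    ring
  rw [Finset.sum_congr rfl fun u _ => hpt u, Finset.sum_sub_distrib, Finset.sum_neg_distrib, hlay]
  ring

end Summit.QuantumFields.BalabanUV.Beta.GAN24.LayerPushGradEntry

end
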